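import Mathlib
import Literature.MathematicalPhysics.QuantumFieldTheory.Balaban1983to89.B12Average012Prop2
import Literature.MathematicalPhysics.QuantumFieldTheory.Balaban1983to89.B7AvgPeriodicity

/-!
# `Balaban1983to89.B12Average012Periodicity` — [Balaban1987RG1] (2.17) «(rU)(b) = U(rb)» for lattice TRANSLATIONS:
# the averaged contour variables (0.11), the average (0.12) and its `k`-fold iterate are TRANSLATION COVARIANT
# (`\overline{τ_{L^ka}U}^k = τ_aŪ^k`), hence periodic configurations stay periodic through the levels with the
# periods of the tori `T^{(k)}` of (0.1) and the averages DESCEND TO THE TORUS — PROVED for the b12 lineage's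
# concrete `ℤᵈ` objects (the periodisation dictionary of `B7AvgPeriodicity`, for [I]'s actual average)

HONEST FRAMING (cell `lit-balaban`, verbatim): statement-level skeleton of published theorems with citation tags;
proofs where landed; nothing here is a claim about the Yang–Mills mass gap.

CITATION HEADER.  T. Bałaban, *Renormalization group approach to lattice gauge field theories. I*, Commun. Math.
Phys. **109** (1987) 249–301, doi:10.1007/bf01215223 [Balaban1987RG1] (cell paper B12 = «[I]»).  PDF held:
`paper:balaban1987-cmp109-rg-i-small-field` (journal page = PDF page + 248); p. 251 [PDF 3] ((0.1), the tori),
pp. 253–254 [PDF 5–6] ((0.11), (0.12)), p. 269 [PDF 21] ((2.17)) re-read this generation from the held text.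
[12] = [B7] = [Balaban1985Averaging], Commun. Math. Phys. **98** (1985) 17–51, (43) p. 24 (the `k`-fold average),
(52) p. 26.  Unit `lit-balaban-r09` gen 9 (display owner of CMP 109; TAKING line `HOME/STATUS.md`
2026-08-21T09:1xZ), HOME `run/shared/lean/pub/lit-balaban/`; SKELETON rows `B12.Eq0.1`, `B12.Eq0.11`, `B12.Eq0.12`,
`B12.Eq2.17-2.18` (cells only; the tree-contour model twin is r20's `B7TranslationCovariance`/`B7AvgPeriodicity`).

WHAT IS PRINTED (verbatim).  p. 251: *«Consider a lattice as a subset of a continuous Euclidean space R^d, or a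
torus T obtained by the usual identification of boundary points of the cube {x ∈ R^d : −L_μ ≤ x_μ ≤ L_μ, μ = 1,
…, d}. We take L_μ = L^m … T_ε = {x ∈ εZ^d + Σ (ε/2)e_μ : −L_μ ≤ x_μ < L_μ, μ = 1, …, d}, (0.1) with a lattice
spacing ε = L^{−K}. This torus determines a sequence of tori denoted by T^{(k)}_{L^kε} …»*  p. 269: *«Now consider
a Euclidean symmetry r of the torus T_η preserving the torus T^{(k+1)}. We define generally (rU)(b) = U(rb), rb =
r(b₋, b₊) = (rb₋, rb₊). (2.17) By their definitions the expressions in (2.1) are invariant with respect to these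
transformations.»*  p. 254, (0.12): `Ū(c)`, `c ∈ T₁^{(j+1)}` — the average is a configuration on the next torus.

DICTIONARY print → Lean.  The fine lattice is `ℤᵈ` (the lineage's carrier, `B12ContourAverage253` DIVERGENCE (a));
a translation `r = τ_v` acts on bond configurations `U : ZdEdge d → β` by `shiftE v U (x, μ) = U (x + v, μ)` (THIS
FILE's one object definition; on site functions it is the tree's `B12Ineq417Flat.shiftCfg`, `curry_shiftE`); a
translation by `a` of the `k`-th lattice is `τ_{L^ka}` of the fine lattice; (0.11) `𝐔(q,x)` ↦
`B12ContourAverage253.Tavg`; (0.12) `Ū` ↦ `B12SmallFieldRegion255.avgBar`; `Ū^k` ↦ `B12Average012Prop2.avgIter012`;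
(52)'s `sup_p‖U(∂p) − 1‖` ↦ `B12Average012Prop2.pdevZ`; a configuration on the torus with sides `L^kN_i` (fine
units) ↦ an `L^kN_i`-periodic configuration on `ℤᵈ` (period `L^kN_i·e_i` in direction `i`); the torus `(ℤ/Nℤ)ᵈ` and
the descent ↦ the tree's `B7AvgPeriodicity.proj`/`descend`.

THE ARGUMENT FORMALISED.  § 2: `⌊(x + La)/L⌋ = ⌊x/L⌋ + a`, `B(y + a) = B(y) + La`.  § 3: the contour `Γ^π_{q,x}`
depends on `x` only through its block and its offset in the block, so `(τ_{La}U)(Γ^π_{q,x}) = U(Γ^π_{q+La,x+La})`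
(`permT_shiftE`, via the tree's `B12Ineq417Flat.hol_shiftCfg`); Federbush's mean sees only the family of values, so
(0.11) is covariant (`Tavg_shiftE`); the straight transporters, the loops of (0.12) and the block sum are covariant
(`lineR_shiftE`, `Ustr_shiftE`, `loopW_Tavg_shiftE`, `sum_blockSites_add`), whence `\overline{τ_{La}U} = τ_aŪ`
(`avgBar_shiftE`) and, by induction with `L^{k+1}a = L^k(La)`, `\overline{τ_{L^ka}U}^k = τ_aŪ^k`
(`avgIter012_shiftE`); `sup_p‖(τ_vU)(∂p) − 1‖ = sup_p‖U(∂p) − 1‖` (`pdevZ_shiftE`).  § 4: periods `L^kN_i e_i` of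
`U` become periods `N_i e_i` of `Ū^k` (`avgIter012_periodic_coord`), the whole period lattice `Nℤᵈ` follows
(`avgIter012_periodic`, the tree's `B7AvgPeriodicity.periodic_of_coord`), and `Ū^k` descends to `(ℤ/Nℤ)ᵈ`
(`avgIter012_descend`, the tree's `descend_proj`).

WHAT IS PROVED (kernel-checked, no `sorry`, axioms `propext`, `Classical.choice`, `Quot.sound`; ONE object
definition `shiftE` (the translation action on bond configurations), NO `Prop` placeholder, net new unproved facts
0): `shiftE_apply`, `curry_shiftE`, `shiftE_zero`, `shiftE_add`, `shiftE_eq_self_iff`, `blockMap_add_smul`,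
`blockBase_add`, `sum_blockSites_add`, `lineR_shiftE`, **`permT_shiftE`**, `Ustr_shiftE`,
`plaquetteHolonomyZd_shiftE`, `pdevZ_shiftE`, **`Tavg_shiftE`**, `loopW_Tavg_shiftE`, **`avgBar_shiftE`**,
**`avgIter012_shiftE`**, **`avgIter012_periodic_coord`**, `avgIter012_periodic`, **`avgIter012_descend`**.

DIVERGENCES FROM PRINT / WHAT IS NOT PROVED (honest scope).  (a) Translations only: the rotations/reflections of
the Euclidean group of the torus in (2.17)–(2.18) are not treated (the corner-cube contour system of the lineage is
translation- but not rotation-symmetric as a labelled family; print's cube-centred `𝐆` is fully symmetric); the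
model-average twin with permutations/reflections is `B12EuclTransf218`/`B12EuclCov567` on the abstract torus
carrier.  (b) The torus of (0.1) (half-integer offsets, sides `2L_μ`) is identified with `(ℤ/Nℤ)ᵈ` by the usual
relabelling, as in `B7AvgPeriodicity`; only the uniform-period descent is spelled (`avgIter012_descend`), the
direction-dependent periods `N_i` are kept at the level of periodicity (`avgIter012_periodic_coord`).  (c) Nothing
analytic is claimed; the covariance is exact algebra valid for every configuration (no regularity needed).  (d) `ℤᵈ`
corner-cube geometry and the lineage's (0.10)–(0.12) as in `B12ContourAverage253` (a)–(c).
-/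

noncomputable section

open NormedSpace Finset

namespace Literature.MathematicalPhysics.QuantumFieldTheory.Balaban1983to89.B12Average012Periodicity

open Literature.MathematicalPhysics.QuantumLattice (ZdEdge blockMap blockBase blockSites mem_blockSites_iff
  plaquetteHolonomyZd)
open B7Prop1Explicit (e hol)
open B7Eq61Linearization (lineR)
open B12AverageCorridor267 (Ustr loopW loopW_def avgM)
open B12ContourAverage253 (permT Tavg fedAvg)
open B12SmallFieldRegion255 (avgBar)
open B12Average012Prop2 (pdevZ avgIter012 avgIter012_zero avgIter012_succ)
open B12Ineq417Flat (shiftCfg shiftCfg_apply hol_shiftCfg)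
open B7AvgPeriodicity (periodic_of_coord descend proj descend_proj)
open MatrixLog (mlog)

variable {d : ℕ}

/-! ## § 1  Translations of bond configurations on `ℤᵈ` -/

section Shift

variable {β : Type*}

/-- [cite: Balaban1987RG1, (2.17) p.269] the translation `τ_v`, `v ∈ ℤᵈ`, acting on a bond configuration of `ℤᵈ`:
`(τ_v U)(⟨x, x + e_μ⟩) = U(⟨x + v, x + v + e_μ⟩)` («(rU)(b) = U(rb)» for `r` a translation; on site functions it is
the tree's `B12Ineq417Flat.shiftCfg`, `curry_shiftE`). -/
def shiftE (v : Fin d → ℤ) (U : ZdEdge d → β) : ZdEdge d → β := fun b => U (b.1 + v, b.2)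

/-- [cite: Balaban1987RG1, (2.17) p.269] unfolding of `τ_v` (elementary API). -/
@[simp] theorem shiftE_apply (v : Fin d → ℤ) (U : ZdEdge d → β) (b : ZdEdge d) :
    shiftE v U b = U (b.1 + v, b.2) := rfl

/-- [cite: Balaban1987RG1, (2.17) p.269] `τ_v` on bond configurations is `B12Ineq417Flat.shiftCfg v` on the curried
configuration (elementary API). -/
theorem curry_shiftE (v : Fin d → ℤ) (U : ZdEdge d → β) :
    Function.curry (shiftE v U) = shiftCfg v (Function.curry U) := rfl

/-- [cite: Balaban1987RG1, (2.17) p.269] `τ_0 = id` (elementary API). -/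
@[simp] theorem shiftE_zero (U : ZdEdge d → β) : shiftE 0 U = U := by
  funext b; simp

/-- [cite: Balaban1987RG1, (2.17) p.269] `τ_{u+v} = τ_u ∘ τ_v` (elementary API). -/
theorem shiftE_add (u v : Fin d → ℤ) (U : ZdEdge d → β) : shiftE (u + v) U = shiftE u (shiftE v U) := by
  funext b; simp [add_assoc]

/-- [cite: Balaban1987RG1, (0.1) p.251] a bond configuration is `τ_v`-invariant (periodic) iff its curried form is
`shiftCfg v`-invariant (elementary API). -/
theorem shiftE_eq_self_iff (v : Fin d → ℤ) (U : ZdEdge d → β) :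
    shiftE v U = U ↔ shiftCfg v (Function.curry U) = Function.curry U := by
  rw [← curry_shiftE]
  constructor
  · intro h; rw [h]
  · intro h
    have := congrArg Function.uncurry h
    simpa only [Function.uncurry_curry] using this

end Shift

/-! ## § 2  Blocks under translations by block multiples -/

section Blocks

variable {L : ℕ}

/-- [cite: Balaban1987RG1, (0.1) p.251] the lattice of blocks: `⌊(x + L·a)/L⌋ = ⌊x/L⌋ + a` (elementary API). -/
theorem blockMap_add_smul (hL : 0 < L) (x a : Fin d → ℤ) :
    blockMap L (x + (L : ℤ) • a) = blockMap L x + a := by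
  funext i
  have hL' : (L : ℤ) ≠ 0 := by exact_mod_cast hL.ne'
  simp only [blockMap, Pi.add_apply, Pi.smul_apply, smul_eq_mul]
  rw [Int.add_mul_ediv_left _ _ hL']

/-- [cite: Balaban1987RG1, (0.1) p.251] block corners: `L·(y + a) = L·y + L·a` (elementary API). -/
theorem blockBase_add (y a : Fin d → ℤ) : blockBase L (y + a) = blockBase L y + (L : ℤ) • a := by
  funext i
  simp only [blockBase, Pi.add_apply, Pi.smul_apply, smul_eq_mul, mul_add]

/-- [cite: Balaban1987RG1, (0.1) p.251] `B(y + a) = B(y) + L·a`: sums over a translated block (elementary API). -/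
theorem sum_blockSites_add {M : Type*} [AddCommMonoid M] (hL : 0 < L) (y a : Fin d → ℤ) (f : (Fin d → ℤ) → M) :
    ∑ x ∈ blockSites L (y + a), f x = ∑ x ∈ blockSites L y, f (x + (L : ℤ) • a) := by
  haveI : NeZero L := ⟨hL.ne'⟩
  have himg : blockSites L (y + a) = (blockSites L y).image (fun x => x + (L : ℤ) • a) := by
    ext x
    simp only [mem_image, mem_blockSites_iff]
    constructor
    · intro hx
      refine ⟨x - (L : ℤ) • a, ?_, by abel⟩
      rw [show x - (L : ℤ) • a = x + (L : ℤ) • (-a) by rw [smul_neg, sub_eq_add_neg], blockMap_add_smul hL, hx]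
      abel
    · rintro ⟨z, hz, rfl⟩
      rw [blockMap_add_smul hL, hz]
  rw [himg, sum_image]
  intro x _ z _ h
  exact add_right_cancel h

end Blocks

/-! ## § 3  Translation covariance of the (0.11) variables and of the (0.12) average -/

section Group

variable {G : Type*} [Group G] {L : ℕ}

/-- [cite: Balaban1987RG1, (2.17) p.269] straight transporters: `(τ_v U)([x, x + l e_μ]) = U([x + v, x + v + l e_μ])`. -/
theorem lineR_shiftE (v : Fin d → ℤ) (R : ZdEdge d → G) (x : Fin d → ℤ) (μ : Fin d) (l : ℕ) :
    lineR (shiftE v R) x μ l = lineR R (x + v) μ l := by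
  unfold lineR
  congr 1
  funext t
  simp only [shiftE_apply, add_right_comm x _ v]

/-- [cite: Balaban1987RG1, p.252] **the contour transporters `U(Γ^π_{q,x})` are translation covariant by block
multiples**: `(τ_{La} U)(Γ^π_{q,x}) = U(Γ^π_{q + La, x + La})` — the contour system `𝐆` of p. 252 is built blockwise
from corner cubes, and `τ_{La}` maps the block of `x` onto the block of `x + La`. -/
theorem permT_shiftE (hL : 0 < L) (U : ZdEdge d → G) (π : Equiv.Perm (Fin d)) (a x : Fin d → ℤ) :
    permT L (shiftE ((L : ℤ) • a) U) π x = permT L U π (x + (L : ℤ) • a) := by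
  unfold permT
  rw [curry_shiftE, hol_shiftCfg, blockMap_add_smul hL, blockBase_add, add_sub_add_right_eq_sub]

/-- [cite: Balaban1987RG1, (0.12) p.254] `(τ_{La} U)(c) = U(c + a)` for the coarse bond variable `U(c) =
U([Lc₋, Lc₊])`. -/
theorem Ustr_shiftE (U : ZdEdge d → G) (a : Fin d → ℤ) (c : ZdEdge d) :
    Ustr L (shiftE ((L : ℤ) • a) U) c = Ustr L U (c.1 + a, c.2) := by
  unfold Ustr
  rw [lineR_shiftE, blockBase_add]

/-- [cite: Balaban1987RG1, (2.17) p.269] plaquette variables are translation covariant: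
`(τ_v U)(∂p) = U(∂(p + v))`. -/
theorem plaquetteHolonomyZd_shiftE (v : Fin d → ℤ) (U : ZdEdge d → G) (x : Fin d → ℤ) (i j : Fin d) :
    plaquetteHolonomyZd (shiftE v U) x i j = plaquetteHolonomyZd U (x + v) i j := by
  simp only [plaquetteHolonomyZd, shiftE_apply, add_right_comm x _ v]

end Group

section Mean

variable {𝔸 : Type*} [NormedRing 𝔸] [NormedAlgebra ℂ 𝔸] [CompleteSpace 𝔸] {L : ℕ}

/-- [cite: Balaban1987RG1, (0.11) p.253] **THE AVERAGED CONTOUR VARIABLES (0.11) ARE TRANSLATION COVARIANT BY BLOCK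
MULTIPLES**: `𝐔_{τ_{La}U}(q, x) = 𝐔_U(q + La, x + La)` (the mean `M` sees only the family of values). -/
theorem Tavg_shiftE (hL : 0 < L) (U : ZdEdge d → 𝔸ˣ) (a x : Fin d → ℤ) :
    Tavg L (shiftE ((L : ℤ) • a) U) x = Tavg L U (x + (L : ℤ) • a) := by
  unfold Tavg
  congr 1
  funext π
  exact permT_shiftE hL U π a x

omit [NormedAlgebra ℂ 𝔸] [CompleteSpace 𝔸] in
/-- [cite: Balaban1985Averaging, (52) p.26] the regularity functional `sup_p ‖U(∂p) − 1‖` of (52) is translation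
invariant: `sup_p ‖(τ_v U)(∂p) − 1‖ = sup_p ‖U(∂p) − 1‖`. -/
theorem pdevZ_shiftE (v : Fin d → ℤ) (U : ZdEdge d → 𝔸ˣ) : pdevZ (shiftE v U) = pdevZ U := by
  rw [pdevZ, pdevZ]
  simp only [plaquetteHolonomyZd_shiftE]
  exact Equiv.iSup_congr (Equiv.prodCongr (Equiv.addRight v) (Equiv.refl (Fin d × Fin d))) fun _ => rfl

/-- [cite: Balaban1987RG1, (0.12) p.254] the (0.12) loops are translation covariant:
`W_x(τ_{La}U; c) = W_{x + La}(U; c + a)`. -/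
theorem loopW_Tavg_shiftE (hL : 0 < L) (U : ZdEdge d → 𝔸ˣ) (a : Fin d → ℤ) (c : ZdEdge d) (x : Fin d → ℤ) :
    loopW L (fun U : ZdEdge d → 𝔸ˣ => Tavg L U) (shiftE ((L : ℤ) • a) U) c x
      = loopW L (fun U : ZdEdge d → 𝔸ˣ => Tavg L U) U (c.1 + a, c.2) (x + (L : ℤ) • a) := by
  rw [loopW_def, loopW_def, Tavg_shiftE hL, Tavg_shiftE hL, lineR_shiftE, Ustr_shiftE, add_right_comm x]

/-- [cite: Balaban1987RG1, (0.12) p.254][cite: Balaban1987RG1, (2.17) p.269] **THE AVERAGE (0.12) OVER THE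
AVERAGED CONTOUR VARIABLES (0.11) IS TRANSLATION COVARIANT**: translating the fine configuration by `L·a` translates
the averaged configuration by `a`, `\overline{τ_{La}U} = τ_a Ū` — the one-step case of the Euclidean covariance of
the averaging operation for lattice translations (the counterpart, for [I]'s actual average, of
`B7TranslationCovariance.avgIter_shiftCfg` for the tree-contour model average (42) of [12]). -/
theorem avgBar_shiftE (hL : 0 < L) (U : ZdEdge d → 𝔸ˣ) (a : Fin d → ℤ) :
    avgBar L (shiftE ((L : ℤ) • a) U) = shiftE a (avgBar L U) := by
  funext c
  rw [shiftE_apply]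
  unfold avgBar avgM
  dsimp only
  rw [Ustr_shiftE, sum_blockSites_add hL]
  simp only [loopW_Tavg_shiftE hL]

/-- [cite: Balaban1987RG1, (0.12) p.254][cite: Balaban1985Averaging, (43) p.24] **THE `k`-FOLD (0.12)/(0.11)
AVERAGE IS TRANSLATION COVARIANT**: `\overline{τ_{L^k a}U}^k = τ_a Ū^k` — a translation by `a` of the `k`-th
lattice is the translation by `L^k a` of the fine lattice. -/
theorem avgIter012_shiftE (hL : 0 < L) :
    ∀ (k : ℕ) (a : Fin d → ℤ) (U : ZdEdge d → 𝔸ˣ),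
      avgIter012 L (shiftE (((L : ℤ) ^ k) • a) U) k = shiftE a (avgIter012 L U k)
  | 0, a, U => by simp [avgIter012_zero]
  | k + 1, a, U => by
      rw [avgIter012_succ, avgIter012_succ, pow_succ, mul_smul, avgIter012_shiftE hL k ((L : ℤ) • a) U,
        avgBar_shiftE hL]

/-! ## § 4  Periodicity: the averages of periodic configurations descend to the tori `T^{(k)}` of (0.1) -/

/-- [cite: Balaban1987RG1, (0.1) p.251] **PERIODIC CONFIGURATIONS STAY PERIODIC THROUGH THE LEVELS, WITH THE PERIODS
OF THE TORI `T^{(k)}`**: if `U` has period `L^k·N_i` in the `i`-th coordinate direction (a configuration on the torus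
of (0.1) with sides `L^k N_i` in units of the fine lattice), then `Ū^k` has period `N_i` in the `i`-th direction
(a configuration on the torus `T^{(k)}` with sides `N_i`); the periods may differ with the direction, as print's
`L_μ`. -/
theorem avgIter012_periodic_coord (hL : 0 < L) (k : ℕ) {N : Fin d → ℤ} {U : ZdEdge d → 𝔸ˣ}
    (hU : ∀ i : Fin d, shiftE ((((L : ℤ) ^ k) * N i) • e i) U = U) (i : Fin d) :
    shiftE (N i • e i) (avgIter012 L U k) = avgIter012 L U k := by
  rw [← avgIter012_shiftE hL k, smul_smul, hU i]

/-- [cite: Balaban1987RG1, (0.1) p.251] uniform period: if `U` is `L^kN`-periodic in every coordinate direction then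
`Ū^k` is invariant under the whole period lattice `Nℤᵈ` of `T^{(k)}`. -/
theorem avgIter012_periodic (hL : 0 < L) (k : ℕ) {N : ℤ} {U : ZdEdge d → 𝔸ˣ}
    (hU : ∀ i : Fin d, shiftE ((((L : ℤ) ^ k) * N) • e i) U = U) (a : Fin d → ℤ) :
    shiftE (N • a) (avgIter012 L U k) = avgIter012 L U k := by
  have hcoord : ∀ i : Fin d, shiftCfg (N • e i) (Function.curry (avgIter012 L U k))
      = Function.curry (avgIter012 L U k) :=
    fun i => (shiftE_eq_self_iff _ _).1 (avgIter012_periodic_coord hL k (N := fun _ => N) hU i)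
  exact (shiftE_eq_self_iff _ _).2 (periodic_of_coord hcoord a)

/-- [cite: Balaban1987RG1, (0.1) p.251] **DESCENT TO THE TORUS `T^{(k)}`**: for an `L^kN`-periodic configuration
`U` on `ℤᵈ` the `k`-fold (0.12)/(0.11) average is a well-defined configuration on the discrete torus `(ℤ/Nℤ)ᵈ`
— the tree's `B7AvgPeriodicity.descend` of the curried `Ū^k` computes `Ū^k`: `descend N Ū^k (proj N x) μ =
Ū^k(⟨x, x + e_μ⟩)`. -/
theorem avgIter012_descend (hL : 0 < L) (k : ℕ) {N : ℕ} [NeZero N] {U : ZdEdge d → 𝔸ˣ}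
    (hU : ∀ i : Fin d, shiftE ((((L : ℤ) ^ k) * (N : ℤ)) • e i) U = U) (x : Fin d → ℤ) (μ : Fin d) :
    descend N (Function.curry (avgIter012 L U k)) (proj N x) μ = avgIter012 L U k (x, μ) := by
  have hper : ∀ a : Fin d → ℤ, shiftCfg ((N : ℤ) • a) (Function.curry (avgIter012 L U k))
      = Function.curry (avgIter012 L U k) :=
    fun a => (shiftE_eq_self_iff _ _).1 (avgIter012_periodic hL k hU a)
  rw [descend_proj _ hper x]
  rfl

end Mean

end Literature.MathematicalPhysics.QuantumFieldTheory.Balaban1983to89.B12Average012Periodicity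

end
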